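import Mathlib.Algebra.MvPolynomial.PDeriv
import Literature.Computability.AlgebraicComplexity.Apolarity
import HarnessLib

/-!
# The apolarity action is a `k[∂]`-module structure: bilinearity, the derivative rule,
# multiplicativity, and `GL`-equivariance

Topic `Literature/Computability/AlgebraicComplexity`; companion to `Apolarity.lean`, which defines
`apolarAction D f` (`D ⌟ f`, constant-coefficient differential operators acting on polynomials,
Iarrobino–Kanev LNM 1721 §1.1; Landsberg 2017 §10.1.2) and deliberately left the module axioms as
follow-ups.  Everything here is elementary and proved (no named facts):

* bilinearity: `apolarAction_add_left/right`, `apolarAction_smul_left/right`,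
  `apolarAction_sum_left/right`, `apolarAction_sub_left`, `apolarAction_C` (`C a ⌟ g = a • g`);
* the **derivative rule** `apolarAction_X_mul : (Xᵢ · D) ⌟ f = Xᵢ ⌟ (D ⌟ f)` and
  `apolarAction_X : Xᵢ ⌟ g = pderiv i g`, whence **multiplicativity**
  `apolarAction_mul : (D₁ D₂) ⌟ f = D₁ ⌟ (D₂ ⌟ f)` (Iarrobino–Kanev §1.1: `k[x]` is a
  `k[∂]`-module);
* `coeff_apolarAction_X`, the Euler-type vanishing `eq_zero_of_forall_apolarAction_X` (a form of
  positive degree with all first partials zero vanishes, characteristic `0`), and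
  `apolarAction_isHomogeneous` (`deg (D ⌟ f) = deg f − deg D`);
* **`GL`-equivariance** `apolarAction_linSubst : D ⌟ (A · f) = A · ((Aᵀ · D) ⌟ f)` for every square
  matrix `A` (`A · f = linSubst A f`, `X i ↦ Σ_j A j i X j`), and for invertible `A` the transport
  rule `apolarAction_linSubst_eq_zero_iff : D ⌟ (A·f) = 0 ↔ (Aᵀ·D) ⌟ f = 0`, i.e.
  `Ann(A · f) = (Aᵀ)⁻¹ · Ann(f)` (Landsberg 2017 §10.1.2; Buczyńska–Buczyński 2021 §3.1);
* `tendsto_coeffVec_X_mul`: multiplication by a variable is coefficientwise continuous.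

Written for route `ValiantsHypothesis/BorderApolarity` (crux `FixedWitnessObstructionQP`,
stmt-ValiantsHypothesis-5778), adapted from the crux work files `Cruxes/…/ApolarityAPI.lean` /
`Disproof.lean` §9 (refuter cdisprove gen 2), where the same lemmas were first checked.

## References

* A. Iarrobino, V. Kanev, *Power sums, Gorenstein algebras, and determinantal loci*, LNM 1721
  (1999), §1.1. [`IarrobinoKanev1999`]
* J. M. Landsberg, *Geometry and complexity theory*, CUP 2017, §10.1.2. [`LandsbergGCT2017`]
* W. Buczyńska, J. Buczyński, *Apolarity, border rank, and multigraded Hilbert scheme*, Duke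
  Math. J. 170 (2021), §3.1. [`BuczynskaBuczynski2021`]
-/

noncomputable section

open MvPolynomial Filter
open scoped Topology Matrix

namespace Literature.Computability.AlgebraicComplexity

section Bilinear

variable {σ : Type*} {k : Type*} [CommRing k]

/-- `apolarAction` as an iterated `Finsupp.sum` over the coefficient functions (definitional).
[cite: IarrobinoKanev1999, §1.1] -/
theorem apolarAction_eq_finsuppSum (D f : MvPolynomial σ k) :
    apolarAction D f = (AddMonoidAlgebra.coeff D).sum (fun e a =>
      (AddMonoidAlgebra.coeff f).sum (fun d b => monomial (d - e)
        (a * b * ∏ i ∈ e.support, (Nat.descFactorial (d i) (e i) : k)))) :=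
  rfl

/-- Additivity of `D ⌟ f` in the operator `D`. [cite: IarrobinoKanev1999, §1.1] -/
theorem apolarAction_add_left (D E f : MvPolynomial σ k) :
    apolarAction (D + E) f = apolarAction D f + apolarAction E f := by
  rw [apolarAction_eq_finsuppSum, apolarAction_eq_finsuppSum, apolarAction_eq_finsuppSum,
    AddMonoidAlgebra.coeff_add]
  apply Finsupp.sum_add_index'
  · intro e
    simp [Finsupp.sum]
  · intro e a₁ a₂
    simp only [Finsupp.sum, ← Finset.sum_add_distrib, ← map_add]
    refine Finset.sum_congr rfl fun d _ => ?_
    congr 1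
    ring

/-- Additivity of `D ⌟ f` in the polynomial `f`. [cite: IarrobinoKanev1999, §1.1] -/
theorem apolarAction_add_right (D f g : MvPolynomial σ k) :
    apolarAction D (f + g) = apolarAction D f + apolarAction D g := by
  rw [apolarAction_eq_finsuppSum, apolarAction_eq_finsuppSum, apolarAction_eq_finsuppSum,
    AddMonoidAlgebra.coeff_add, ← Finsupp.sum_add]
  refine Finsupp.sum_congr fun e _ => ?_
  apply Finsupp.sum_add_index'
  · intro d
    simp
  · intro d b₁ b₂
    rw [← map_add]
    congr 1
    ring

/-- Homogeneity of `D ⌟ f` in the operator: `(c • D) ⌟ f = c • (D ⌟ f)`. [cite: IarrobinoKanev1999, §1.1] -/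
theorem apolarAction_smul_left (c : k) (D f : MvPolynomial σ k) :
    apolarAction (c • D) f = c • apolarAction D f := by
  rw [apolarAction_eq_finsuppSum, apolarAction_eq_finsuppSum, AddMonoidAlgebra.coeff_smul,
    Finsupp.sum_smul_index']
  · simp only [Finsupp.sum, Finset.smul_sum, smul_monomial, smul_eq_mul]
    refine Finset.sum_congr rfl fun e _ => Finset.sum_congr rfl fun d _ => ?_
    congr 1
    ring
  · intro e
    simp [Finsupp.sum]

/-- Homogeneity of `D ⌟ f` in the polynomial: `D ⌟ (c • f) = c • (D ⌟ f)`. [cite: IarrobinoKanev1999, §1.1] -/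
theorem apolarAction_smul_right (c : k) (D f : MvPolynomial σ k) :
    apolarAction D (c • f) = c • apolarAction D f := by
  rw [apolarAction_eq_finsuppSum, apolarAction_eq_finsuppSum, AddMonoidAlgebra.coeff_smul,
    Finsupp.smul_sum]
  refine Finsupp.sum_congr fun e _ => ?_
  rw [Finsupp.sum_smul_index', Finsupp.smul_sum]
  · refine Finsupp.sum_congr fun d _ => ?_
    rw [smul_monomial, smul_eq_mul]
    congr 1
    ring
  · intro d
    simp

/-- Finite additivity in the operator. [cite: IarrobinoKanev1999, §1.1] -/
theorem apolarAction_sum_left {ι : Type*} (s : Finset ι) (D : ι → MvPolynomial σ k)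
    (f : MvPolynomial σ k) : apolarAction (∑ i ∈ s, D i) f = ∑ i ∈ s, apolarAction (D i) f := by
  classical
  induction s using Finset.induction_on with
  | empty => simp
  | insert a s ha ih => rw [Finset.sum_insert ha, Finset.sum_insert ha, apolarAction_add_left, ih]

/-- Finite additivity in the polynomial. [cite: IarrobinoKanev1999, §1.1] -/
theorem apolarAction_sum_right {ι : Type*} (s : Finset ι) (D : MvPolynomial σ k)
    (f : ι → MvPolynomial σ k) : apolarAction D (∑ i ∈ s, f i) = ∑ i ∈ s, apolarAction D (f i) := by
  classical
  induction s using Finset.induction_on with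
  | empty => simp
  | insert a s ha ih => rw [Finset.sum_insert ha, Finset.sum_insert ha, apolarAction_add_right, ih]

/-- Subtraction in the operator. [cite: IarrobinoKanev1999, §1.1] -/
theorem apolarAction_sub_left (D E f : MvPolynomial σ k) :
    apolarAction (D - E) f = apolarAction D f - apolarAction E f := by
  rw [sub_eq_add_neg, apolarAction_add_left, ← neg_one_smul k E, apolarAction_smul_left, neg_one_smul,
    sub_eq_add_neg]

/-- Constants act as scalars: `C a ⌟ g = a • g`. [cite: IarrobinoKanev1999, §1.1] -/
theorem apolarAction_C (a : k) (g : MvPolynomial σ k) : apolarAction (C a) g = a • g := by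
  classical
  conv_lhs => rw [as_sum g]
  rw [apolarAction_sum_right]
  conv_rhs => rw [as_sum g, Finset.smul_sum]
  refine Finset.sum_congr rfl fun d _ => ?_
  rw [← monomial_zero', apolarAction_monomial_monomial, tsub_zero, smul_monomial, smul_eq_mul,
    Finsupp.support_zero, Finset.prod_empty, mul_one]

/-! ### The monomial coefficient and the derivative rule -/

/-- The descending-factorial coefficient of the monomial formula satisfies
`c(d, e + eᵢ) = c(d, e) · (dᵢ − eᵢ)`. [folklore] -/
theorem prod_descFactorial_add_single (d e : σ →₀ ℕ) (i : σ) :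
    (∏ j ∈ (e + Finsupp.single i 1).support,
        (Nat.descFactorial (d j) ((e + Finsupp.single i 1 : σ →₀ ℕ) j) : k)) =
      (∏ j ∈ e.support, (Nat.descFactorial (d j) (e j) : k)) * ((d i - e i : ℕ) : k) := by
  classical
  set S := insert i e.support with hS
  have hsub1 : (e + Finsupp.single i 1).support ⊆ S := by
    intro j hj
    rw [hS, Finset.mem_insert]
    by_cases hji : j = i
    · exact Or.inl hji
    · right
      rw [Finsupp.mem_support_iff] at hj ⊢
      simpa [Finsupp.single_apply, Ne.symm hji] using hj
  have hsub2 : e.support ⊆ S := Finset.subset_insert _ _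
  have h1 : ∏ j ∈ (e + Finsupp.single i 1).support,
      (Nat.descFactorial (d j) ((e + Finsupp.single i 1 : σ →₀ ℕ) j) : k) =
      ∏ j ∈ S, (Nat.descFactorial (d j) ((e + Finsupp.single i 1 : σ →₀ ℕ) j) : k) :=
    Finset.prod_subset hsub1 fun j _ hj => by
      rw [Finsupp.notMem_support_iff] at hj
      rw [hj, Nat.descFactorial_zero, Nat.cast_one]
  have h2 : ∏ j ∈ e.support, (Nat.descFactorial (d j) (e j) : k) =
      ∏ j ∈ S, (Nat.descFactorial (d j) (e j) : k) :=
    Finset.prod_subset hsub2 fun j _ hj => by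
      rw [Finsupp.notMem_support_iff] at hj
      rw [hj, Nat.descFactorial_zero, Nat.cast_one]
  have hi : i ∈ S := Finset.mem_insert_self _ _
  rw [h1, h2, ← Finset.mul_prod_erase S _ hi, ← Finset.mul_prod_erase S _ hi]
  have h3 : ∏ j ∈ S.erase i, (Nat.descFactorial (d j) ((e + Finsupp.single i 1 : σ →₀ ℕ) j) : k) =
      ∏ j ∈ S.erase i, (Nat.descFactorial (d j) (e j) : k) := by
    refine Finset.prod_congr rfl fun j hj => ?_
    have hji : j ≠ i := Finset.ne_of_mem_erase hj
    simp [hji.symm]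
  rw [h3]
  simp only [Finsupp.add_apply, Finsupp.single_eq_same]
  rw [Nat.descFactorial_succ]
  push_cast
  ring

/-- The coefficient of the monomial formula for `e = eᵢ` is `dᵢ`. [folklore] -/
theorem prod_descFactorial_single (d : σ →₀ ℕ) (i : σ) :
    (∏ j ∈ (Finsupp.single i 1).support,
        (Nat.descFactorial (d j) ((Finsupp.single i 1 : σ →₀ ℕ) j) : k)) = ((d i : ℕ) : k) := by
  classical
  rw [Finsupp.support_single _ one_ne_zero, Finset.prod_singleton, Finsupp.single_eq_same,
    Nat.descFactorial_one]

/-- **Derivative rule**: `(Xᵢ · D) ⌟ f = Xᵢ ⌟ (D ⌟ f)`, i.e. `∂ᵢ ∘ D(∂) = (∂ᵢ D)(∂)`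
(Iarrobino–Kanev §1.1: the action is a ring action of `k[∂]`). [cite: IarrobinoKanev1999, §1.1] -/
theorem apolarAction_X_mul (i : σ) (D f : MvPolynomial σ k) :
    apolarAction (X i * D) f = apolarAction (X i) (apolarAction D f) := by
  classical
  -- reduce to monomials by bilinearity
  conv_lhs => rw [as_sum D, as_sum f, Finset.mul_sum]
  conv_rhs => rw [as_sum D, as_sum f]
  simp only [apolarAction_sum_left, apolarAction_sum_right]
  refine Finset.sum_congr rfl fun e _ => Finset.sum_congr rfl fun d _ => ?_
  rw [X, monomial_mul, apolarAction_monomial_monomial, apolarAction_monomial_monomial,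
    apolarAction_monomial_monomial, one_mul, add_comm (Finsupp.single i 1),
    prod_descFactorial_add_single, tsub_tsub, prod_descFactorial_single, Finsupp.tsub_apply]
  congr 1
  ring

/-- Coefficients of `Xᵢ ⌟ g` (the partial derivative): `(Xᵢ ⌟ g)_u = (uᵢ + 1) g_{u + eᵢ}`.
[cite: IarrobinoKanev1999, §1.1] -/
theorem coeff_apolarAction_X (i : σ) (g : MvPolynomial σ k) (u : σ →₀ ℕ) :
    coeff u (apolarAction (X i) g) = ((u i + 1 : ℕ) : k) * coeff (u + Finsupp.single i 1) g := by
  classical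
  conv_lhs => rw [as_sum g]
  rw [apolarAction_sum_right, coeff_sum]
  simp only [X, apolarAction_monomial_monomial, one_mul, coeff_monomial, prod_descFactorial_single]
  rw [Finset.sum_eq_single (u + Finsupp.single i 1)]
  · simp only [add_tsub_cancel_right, if_true, Finsupp.add_apply, Finsupp.single_eq_same]
    ring
  · intro d _ hne
    split_ifs with h
    · -- `d - eᵢ = u` but `d ≠ u + eᵢ` forces `dᵢ = 0`
      have hdi : d i = 0 := by
        by_contra hpos
        apply hne
        ext j
        have := congrArg (fun f : σ →₀ ℕ => f j) h
        simp only [Finsupp.tsub_apply, Finsupp.single_apply] at this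
        simp only [Finsupp.add_apply, Finsupp.single_apply]
        by_cases hji : i = j
        · subst hji; simp only [if_true] at this ⊢; omega
        · simp only [if_neg hji] at this ⊢; omega
      rw [hdi, Nat.cast_zero, mul_zero]
    · rfl
  · intro hn
    rw [if_pos (add_tsub_cancel_right _ _), notMem_support_iff.1 hn, zero_mul]

/-- **Euler-type vanishing**: in characteristic `0`, a form of positive degree all of whose first
partials `Xᵢ ⌟ g` vanish is zero. [folklore] -/
theorem eq_zero_of_forall_apolarAction_X [CharZero k] [IsDomain k] {g : MvPolynomial σ k} {j : ℕ}
    (hg : g.IsHomogeneous j) (hj : 1 ≤ j) (h : ∀ i, apolarAction (X i) g = 0) : g = 0 := by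
  classical
  by_contra hne
  obtain ⟨d, hd⟩ := ne_zero_iff.1 hne
  have hdeg : d.degree = j := by
    rw [Finsupp.degree_eq_weight_one]; exact hg hd
  obtain ⟨i, hi⟩ : ∃ i, d i ≠ 0 := by
    by_contra hcon
    push Not at hcon
    have : d = 0 := Finsupp.ext hcon
    rw [this, map_zero] at hdeg
    omega
  have key := congrArg (coeff (d - Finsupp.single i 1)) (h i)
  rw [coeff_apolarAction_X, coeff_zero] at key
  have hsub : d - Finsupp.single i 1 + Finsupp.single i 1 = d := by
    apply tsub_add_cancel_of_le
    exact Finsupp.single_le_iff.2 (Nat.one_le_iff_ne_zero.2 hi)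
  rw [hsub] at key
  rcases mul_eq_zero.1 key with h1 | h2
  · exact absurd h1 (Nat.cast_ne_zero.2 (Nat.succ_ne_zero _))
  · exact hd h2

/-- `D ⌟ f` of forms is a form: `deg (D ⌟ f) = deg f − deg D`. [cite: IarrobinoKanev1999, §1.1] -/
theorem apolarAction_isHomogeneous {D f : MvPolynomial σ k} {j m : ℕ} (hD : D.IsHomogeneous j)
    (hf : f.IsHomogeneous m) : (apolarAction D f).IsHomogeneous (m - j) := by
  classical
  rw [apolarAction_def]
  refine IsHomogeneous.sum _ _ _ fun e he => IsHomogeneous.sum _ _ _ fun d hd => ?_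
  by_cases hle : e ≤ d
  · apply isHomogeneous_monomial
    have hedeg : e.degree = j := by
      rw [Finsupp.degree_eq_weight_one]; exact hD (mem_support_iff.1 he)
    have hddeg : d.degree = m := by
      rw [Finsupp.degree_eq_weight_one]; exact hf (mem_support_iff.1 hd)
    have : (d - e).degree + e.degree = d.degree := by
      rw [← map_add, tsub_add_cancel_of_le hle]
    omega
  · have := apolarAction_monomial_monomial_of_not_le hle (coeff e D) (coeff d f)
    rw [apolarAction_monomial_monomial] at this
    rw [this]
    exact isHomogeneous_zero _ _ _

/-- `Xᵢ ⌟ g = ∂g/∂xᵢ` (Mathlib's `pderiv`). [cite: IarrobinoKanev1999, §1.1] -/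
theorem apolarAction_X (i : σ) (g : MvPolynomial σ k) : apolarAction (X i) g = pderiv i g := by
  classical
  conv_lhs => rw [as_sum g]
  conv_rhs => rw [as_sum g]
  rw [apolarAction_sum_right, map_sum]
  refine Finset.sum_congr rfl fun d _ => ?_
  rw [X, apolarAction_monomial_monomial, pderiv_monomial, one_mul, prod_descFactorial_single]

/-- **Multiplicativity**: `(D₁ D₂) ⌟ f = D₁ ⌟ (D₂ ⌟ f)` — `f ↦ D ⌟ f` makes `k[x]` a
`k[∂]`-module. [cite: IarrobinoKanev1999, §1.1] -/
theorem apolarAction_mul (D₁ D₂ f : MvPolynomial σ k) :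
    apolarAction (D₁ * D₂) f = apolarAction D₁ (apolarAction D₂ f) := by
  classical
  induction D₁ using MvPolynomial.induction_on generalizing D₂ with
  | C a =>
    rw [apolarAction_C, ← smul_eq_C_mul, apolarAction_smul_left]
  | add p q hp hq =>
    rw [add_mul, apolarAction_add_left, apolarAction_add_left, hp, hq]
  | mul_X p i hp =>
    rw [mul_comm p (X i), mul_assoc, apolarAction_X_mul, hp, ← apolarAction_X_mul]

/-- Multiplication by a variable is coefficientwise continuous (`coeffVec`, product topology).
[folklore] -/
theorem tendsto_coeffVec_X_mul {𝕜 : Type*} [Field 𝕜] [TopologicalSpace 𝕜]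
    {Ds : ℕ → MvPolynomial σ 𝕜} {D : MvPolynomial σ 𝕜} (i : σ)
    (h : Tendsto (fun t => coeffVec (Ds t)) atTop (𝓝 (coeffVec D))) :
    Tendsto (fun t => coeffVec (X i * Ds t)) atTop (𝓝 (coeffVec (X i * D))) := by
  classical
  rw [tendsto_pi_nhds] at h ⊢
  intro u
  simp only [coeffVec_apply, coeff_X_mul']
  split_ifs
  · exact h _
  · exact tendsto_const_nhds

end Bilinear

/-! ### `GL`-equivariance -/

section Equivariance

variable {σ : Type*} [Fintype σ] {k : Type*} [CommRing k]

/-- Chain rule for one partial derivative through a linear substitution (any commutative ring):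
`∂ᵢ (A · g) = Σ_j A i j · A · (∂ⱼ g)`, i.e. `Xᵢ ⌟ (A·g) = A·((Aᵀ·Xᵢ) ⌟ g)`.  (Over a field this is
`Literature.Barriers.ValiantsHypothesis.pderiv_linSubst`.) [folklore] -/
theorem pderiv_linSubst_eq_sum (A : Matrix σ σ k) (i : σ) (g : MvPolynomial σ k) :
    pderiv i (linSubst σ k A g) = ∑ j, A i j • linSubst σ k A (pderiv j g) := by
  classical
  induction g using MvPolynomial.induction_on with
  | C c =>
    simp
  | add p q hp hq =>
    simp only [map_add, hp, hq, smul_add, Finset.sum_add_distrib]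
  | mul_X p l hp =>
    have h1 : pderiv i (linSubst σ k A (X l)) = C (A i l) := by
      rw [linSubst_X, map_sum, Finset.sum_eq_single i]
      · rw [Derivation.map_smul, pderiv_X, Pi.single_eq_same, smul_eq_C_mul, mul_one]
      · intro j _ hji
        rw [Derivation.map_smul, pderiv_X, Pi.single_eq_of_ne hji, smul_zero]
      · intro h
        exact absurd (Finset.mem_univ i) h
    have lhs : pderiv i (linSubst σ k A (p * X l)) =
        A i l • linSubst σ k A p + linSubst σ k A (X l) * pderiv i (linSubst σ k A p) := by
      rw [map_mul, Derivation.leibniz, h1, smul_eq_mul, smul_eq_mul, mul_comm (linSubst σ k A p) (C _),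
        ← smul_eq_C_mul]
    have hj : ∀ j, linSubst σ k A (pderiv j (p * X l)) =
        (if l = j then linSubst σ k A p else 0) + linSubst σ k A (X l) * linSubst σ k A (pderiv j p) := by
      intro j
      rw [Derivation.leibniz, pderiv_X, smul_eq_mul, smul_eq_mul, map_add, map_mul, map_mul]
      congr 1
      simp only [Pi.single_apply]
      split_ifs with h <;> simp
    have rhs : (∑ j, A i j • linSubst σ k A (pderiv j (p * X l))) =
        A i l • linSubst σ k A p + linSubst σ k A (X l) * ∑ j, A i j • linSubst σ k A (pderiv j p) := by
      simp only [hj, smul_add, Finset.sum_add_distrib]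
      congr 1
      · simp only [smul_ite, smul_zero, Finset.sum_ite_eq, Finset.mem_univ, if_true]
      · rw [Finset.mul_sum]
        refine Finset.sum_congr rfl fun j _ => ?_
        rw [mul_smul_comm]
    rw [lhs, rhs, hp]

/-- **`GL`-equivariance of apolarity**: `D ⌟ (A · f) = A · ((Aᵀ · D) ⌟ f)` for every square matrix `A`
(`A · f = linSubst A f`, i.e. `f ∘ Aᵀ`).  Landsberg 2017 §10.1.2; Buczyńska–Buczyński 2021 §3.1.
[cite: LandsbergGCT2017, §10.1.2] -/
theorem apolarAction_linSubst (A : Matrix σ σ k) (D f : MvPolynomial σ k) :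
    apolarAction D (linSubst σ k A f) = linSubst σ k A (apolarAction (linSubst σ k Aᵀ D) f) := by
  classical
  induction D using MvPolynomial.induction_on generalizing f with
  | C a =>
    rw [linSubst_C, apolarAction_C, apolarAction_C, map_smul]
  | add p q hp hq =>
    rw [apolarAction_add_left, map_add, apolarAction_add_left, map_add, hp, hq]
  | mul_X p i hp =>
    rw [mul_comm p (X i), apolarAction_X_mul, hp, apolarAction_X, pderiv_linSubst_eq_sum, map_mul,
      apolarAction_mul, linSubst_X, apolarAction_sum_left, map_sum]
    refine Finset.sum_congr rfl fun j _ => ?_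
    rw [apolarAction_smul_left, map_smul, apolarAction_X, Matrix.transpose_apply]

/-- `linSubst A` is injective for invertible `A`. [folklore] -/
theorem linSubst_injective_of_isUnit_det [DecidableEq σ] (A : Matrix σ σ k) (hA : IsUnit A.det) :
    Function.Injective (linSubst σ k A) := by
  intro x y hxy
  have := congrArg (linSubst σ k A⁻¹) hxy
  simp only [← AlgHom.comp_apply, ← linSubst_mul, Matrix.nonsing_inv_mul _ hA, linSubst_one,
    AlgHom.id_apply] at this
  exact this

/-- **Transport of annihilators**: for invertible `A`, `D ⌟ (A·f) = 0 ↔ (Aᵀ·D) ⌟ f = 0`, i.e.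
`Ann(A · f) = {D : Aᵀ · D ∈ Ann f}`.  Landsberg 2017 §10.1.2. [cite: LandsbergGCT2017, §10.1.2] -/
theorem apolarAction_linSubst_eq_zero_iff [DecidableEq σ] (A : Matrix σ σ k) (hA : IsUnit A.det)
    (D f : MvPolynomial σ k) :
    apolarAction D (linSubst σ k A f) = 0 ↔ apolarAction (linSubst σ k Aᵀ D) f = 0 := by
  rw [apolarAction_linSubst]
  constructor
  · intro h
    exact linSubst_injective_of_isUnit_det A hA (h.trans (map_zero _).symm)
  · intro h
    rw [h, map_zero]

end Equivariance

end Literature.Computability.AlgebraicComplexity
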